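import Literature.NumberTheory.GaloisCohomology.Howard2004.DualityDatumLocalTwoSocleProofs
import HarnessLib

/-!
# Readings, coordinates and the rank-one socle of `H²(K_v, R(1))` from a FROBENIUS character of the level ring
# (Howard 2004 §1.3 H.4 for NON-FREE level rings; proofs file)

Topic `NumberTheory/GaloisCohomology/Howard2004`. THEOREMS ONLY: no definition, no named fact, no instance, no
notation, no `sorry`. Cell `pub/bsd-print-x9`, print leaf G87 `thm161_dvrKolyvaginBound` (Howard Thm. 1.6.1); seat
`bsd-line-x9-p1-w4` g16, brick (READ-REBASE) part 1 = the Frobenius-form TWIN of `DualityDatumLocalTwoSocleProofs` §3–§4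
and of `InertLagrangianTransferProofs` §1.

WHY (x10b-p1-w6 g9 «READ-NONFREE», bsd-line-x10b-p1 LEAD g12 ruling 2026-08-29): the earlier readout files take a
DUALIZING FAMILY `hbij : Bijective fun x : R => fun i => exp (λ(r_i x))`, i.e. `(R, +) ≅ (ℤ/p^k)^ι` — false for the refined
levels `R/π^e` of a ramified DVR (`(R/π^e, +) ≅ ⊕_{j<m} ℤ/p^{⌈(e−j)/m⌉}`).  What every finite local ring with principal
maximal ideal does carry is a FROBENIUS character: one additive `λ : R → ℤ/p^k` with `c ↦ λ_c = λ(c ·)` BIJECTIVE onto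
`Hom(R, ℤ/p^k)` [Howard §2.1 «`Hom_{S_𝔭}(N, 𝒟_𝔭(1)) ≅ Hom_{ℤ_p}(N, μ_{p^∞})`»].  This file re-proves the readout
consequences from the two Prop-binders

  `hfrob : Bijective fun c : R => lamMul lam c`                                   (Frobenius character), and
  `hdet  : ∀ z : H²(K_v, R(1)), (∀ b, H²(exp ∘ λ_b) z = 0) → z = 0`                (H²-detection by the readings),

both true at every level (at additively free levels they follow from `hbij`: `DualityDatumLocalTwoSocleProofs.exists_eq_lamMul`,
`DualityDatumLocalCupAnnihilatorProofs.eq_zero_of_forall_cohomologyMap_expLam_lamMul_eq_zero`):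

  * §1 `eq_zero_of_forall_lamMul_apply_eq_zero`, `eq_of_forall_lamMul_apply_eq`, `exists_forall_eq_lamMul_apply`;
  * §2 `exists_forall_reading_eq_lam_mul_frob` (coordinates of a class), `eq_of_forall_reading_eq_frob`;
  * §3 **`exists_eq_scalarMap_two_of_scalarMap_two_eq_zero_frob`** — (hP) for `P = H²(K_v, R(1))`;
  * §4 **`exists_coord_frob`** — a coordinate FUNCTION `coord : H²(K_v, R(1)) → R` (readings, additive, `R`-semilinear,
    `coord z = 0 ↔ z = 0`).

NOT HERE: the Frobenius character of a given ring (x10b-p1-w6's (FROB-CHAR)) and the H²-detection for `R(1) ≅ ⊕ μ_{p^{a_j}}`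
((READ-H2)); `thm161_dvrKolyvaginBound` is NOT proved; no summit statement is proved; the Birch–Swinnerton-Dyer
conjecture is not proved by any of this.
References: [Howard2004HeegnerKolyvagin] §1.3 H.4, §2.1, Lemma 1.5.7; [MilneADT2006] I Cor. 2.3; [SerreGaloisCohomology1997] I §2.2–2.3.
-/

set_option autoImplicit false

noncomputable section

open CategoryTheory Function NumberField IsDedekindDomain Field
open scoped ContRepresentation NumberField

namespace Literature.NumberTheory.GaloisCohomology.Howard2004

open Literature.NumberTheory.GaloisRepresentations
open Literature.NumberTheory.GaloisRepresentations.DiscreteGaloisModule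

/-! ## §1 Characters of the level ring from a Frobenius character (no Galois module involved) -/

namespace DualityDatum

section Characters

variable {R : Type} [CommRing R] {p : ℕ} {k : ℕ} (lam : R →+ ZMod (p ^ k))

/-- `λ(c b) = 0` for all `b` forces `c = 0` (injectivity of `c ↦ λ_c`).
[cite: Howard2004HeegnerKolyvagin, §1.3 H.4 (arXiv p. 7, L78–82: «perfect») and §2.1 (arXiv p. 13, L20–24)] -/
theorem eq_zero_of_forall_lamMul_apply_eq_zero (hfrob : Bijective fun c : R => lamMul lam c) (c : R)
    (hc : ∀ b, lam (c * b) = 0) : c = 0 := by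
  apply hfrob.1
  refine AddMonoidHom.ext fun b => ?_
  change lamMul lam c b = lamMul lam 0 b
  rw [lamMul_apply, lamMul_apply, hc, zero_mul, map_zero]

/-- Coordinates are unique: `λ(c b) = λ(c' b)` for all `b` forces `c = c'`.
[cite: Howard2004HeegnerKolyvagin, §1.3 H.4 (arXiv p. 7, L78–82: «perfect»)] -/
theorem eq_of_forall_lamMul_apply_eq (hfrob : Bijective fun c : R => lamMul lam c) {c c' : R}
    (h : ∀ b : R, lam (c * b) = lam (c' * b)) : c = c' := by
  rw [← sub_eq_zero]
  refine eq_zero_of_forall_lamMul_apply_eq_zero lam hfrob _ fun b => ?_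
  rw [sub_mul, map_sub, sub_eq_zero, h]

/-- **Every additive character `φ : R → ℤ/p^k` is `λ_c = λ(c ·)`** (surjectivity of `c ↦ λ_c`).
[cite: Howard2004HeegnerKolyvagin, §2.1 (arXiv p. 13, L20–24: «Hom_{S_𝔭}(N, 𝒟_𝔭(1)) ≅ Hom_{ℤ_p}(N, μ_{p^∞})»)] -/
theorem exists_forall_eq_lamMul_apply (hfrob : Bijective fun c : R => lamMul lam c) (φ : R →+ ZMod (p ^ k)) :
    ∃ c : R, ∀ b, φ b = lam (c * b) := by
  obtain ⟨c, hc⟩ := hfrob.2 φ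
  refine ⟨c, fun b => ?_⟩
  have := DFunLike.congr_fun hc b
  rw [lamMul_apply] at this
  exact this.symm

end Characters

end DualityDatum

variable {K : Type} [Field K] [NumberField K] {M : Type} [AddCommGroup M] [TopologicalSpace M]
  [DiscreteTopology M] {R : Type} [CommRing R] [Module R M] [TopologicalSpace R] [DiscreteTopology R]
  {p : ℕ} [Fact p.Prime] [Algebra ℤ_[p] R] {cd : ConjugationDatum K} {ρ : DiscreteGaloisModule K M}
  (D : DualityDatum p cd ρ R) {k : ℕ}
  (lam : R →+ ZMod (p ^ k))
  (hlam : ∀ (z : ℤ_[p]) (r : R), lam (algebraMap ℤ_[p] R z * r) = PadicInt.toZModPow k z * lam r)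
  (exp : ZMod (p ^ k) →+ MuCarrier K (p ^ k))
  (hexp : ∀ (g : absoluteGaloisGroup K) (x : ZMod (p ^ k)),
    exp (cyclotomicCharacterModPow K p k g * x) = mu K (p ^ k) g (exp x))

namespace DualityDatum

/-! ## §2 Coordinates of a class from the Frobenius character -/

include hlam in
/-- **Coordinates of a class**: for every `z ∈ H²(K_v, R(1))` there is `c ∈ R` with `ι H²(exp ∘ λ_b) z = λ(c b)` for ALL
`b ∈ R` — the reading `b ↦ ι H²(exp ∘ λ_b) z` is an additive character of `R` (`cohomologyMap_expLam_add`), hence some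
`λ_c` by the Frobenius property. [cite: Howard2004HeegnerKolyvagin, §1.3 H.4 (arXiv p. 7, L78–82: «⟨ , ⟩_v : H¹(K_v,T) × H¹(K_v̄,T) → R»)] [cite: MilneADT2006, Ch. I Cor. 2.3] -/
theorem exists_forall_reading_eq_lam_mul_frob (hfrob : Bijective fun c : R => lamMul lam c) (v : Place K)
    (ι₀ : galoisCohomology ((mu K (p ^ k)).toLocal v) 2 →+ ZMod (p ^ k))
    (z : galoisCohomology (D.twistOne.toLocal v) 2) :
    ∃ c : R, ∀ b : R,
      ι₀ (cohomologyMap (D.expLamLocalHom (lamMul lam b) (lamMul_semilinear lam hlam b) exp hexp v) 2 z) = lam (c * b) := by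
  -- the reading as an additive character of `R`
  let Φ : R →+ ZMod (p ^ k) := AddMonoidHom.mk'
    (fun b => ι₀ (cohomologyMap (D.expLamLocalHom (lamMul lam b) (lamMul_semilinear lam hlam b) exp hexp v) 2 z))
    fun b b' => by
      change ι₀ _ = ι₀ _ + ι₀ _
      rw [D.cohomologyMap_expLamLocalHom_congr exp hexp v (lamMul_add lam b b') (lamMul_semilinear lam hlam (b + b'))
        (add_semilinear (lamMul_semilinear lam hlam b) (lamMul_semilinear lam hlam b')) z,
        D.cohomologyMap_expLam_add exp hexp v (lamMul_semilinear lam hlam b) (lamMul_semilinear lam hlam b') z]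
      exact map_add ι₀ _ _
  obtain ⟨c, hc⟩ := exists_forall_eq_lamMul_apply lam hfrob Φ
  refine ⟨c, fun b => ?_⟩
  have := hc b
  rw [AddMonoidHom.mk'_apply] at this
  exact this

include hlam in
/-- Classes with the same readings `ι H²(exp ∘ λ_b)`, `b ∈ R`, are equal (H²-detection `hdet` + `ι` injective).
[cite: Howard2004HeegnerKolyvagin, §1.3 H.4 (arXiv p. 7, L78–82)] [cite: MilneADT2006, Ch. I Cor. 2.3] -/
theorem eq_of_forall_reading_eq_frob (v : Place K)
    (hdet : ∀ z : galoisCohomology (D.twistOne.toLocal v) 2,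
      (∀ b : R, cohomologyMap (D.expLamLocalHom (lamMul lam b) (lamMul_semilinear lam hlam b) exp hexp v) 2 z = 0) →
        z = 0)
    (ι₀ : galoisCohomology ((mu K (p ^ k)).toLocal v) 2 →+ ZMod (p ^ k)) (hι₀ : Injective ι₀)
    (z z' : galoisCohomology (D.twistOne.toLocal v) 2)
    (h : ∀ b : R, ι₀ (cohomologyMap (D.expLamLocalHom (lamMul lam b) (lamMul_semilinear lam hlam b) exp hexp v) 2 z) =
      ι₀ (cohomologyMap (D.expLamLocalHom (lamMul lam b) (lamMul_semilinear lam hlam b) exp hexp v) 2 z')) :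
    z = z' := by
  rw [← sub_eq_zero]
  refine hdet _ fun b => ?_
  exact (map_sub _ z z').trans (sub_eq_zero.2 (hι₀ (h b)))

/-! ## §3 (hP): the `ϖ`-torsion of `H²(K_v, R(1))` has rank at most one -/

include hlam hexp in
/-- **(hP) for `P = H²(K_v, R(1))`, Frobenius form.**  With a Frobenius character `λ`, H²-detection at `v`, an injective
`ι : H²(K_v, μ_{p^k}) → ℤ/p^k` and a rank-`≤ 1` `ϖ`-socle of `R` (`ϖ a = 0 → ϖ b = 0 → a ≠ 0 → ∃ c, b = c a`, e.g. every
quotient of a DVR, `QuotientDVRSocleCyclicProofs`): for `P, Q ∈ H²(K_v, R(1))` with `H²(ϖ•) P = 0 = H²(ϖ•) Q` and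
`P ≠ 0` there is `c ∈ R` with `Q = H²(c•) P`.
[cite: Howard2004HeegnerKolyvagin, §1.3 H.4 (arXiv p. 7, L78–82) and Lemma 1.5.7 (p. 10 L105–127)] [cite: MilneADT2006, Ch. I Cor. 2.3] -/
theorem exists_eq_scalarMap_two_of_scalarMap_two_eq_zero_frob (hfrob : Bijective fun c : R => lamMul lam c)
    (v : Place K)
    (hdet : ∀ z : galoisCohomology (D.twistOne.toLocal v) 2,
      (∀ b : R, cohomologyMap (D.expLamLocalHom (lamMul lam b) (lamMul_semilinear lam hlam b) exp hexp v) 2 z = 0) →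
        z = 0)
    (ι₀ : galoisCohomology ((mu K (p ^ k)).toLocal v) 2 →+ ZMod (p ^ k)) (hι₀ : Injective ι₀)
    (ϖ : R) (hsoc : ∀ a b : R, ϖ * a = 0 → ϖ * b = 0 → a ≠ 0 → ∃ c : R, b = c * a)
    (P Q : galoisCohomology (D.twistOne.toLocal v) 2)
    (hP : galoisCohomology.scalarMap (D.twistOne.toLocal v) (isScalarLinear_toLocal D.isScalarLinear_twistOne v) 2 ϖ P = 0)
    (hQ : galoisCohomology.scalarMap (D.twistOne.toLocal v) (isScalarLinear_toLocal D.isScalarLinear_twistOne v) 2 ϖ Q = 0)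
    (hP0 : P ≠ 0) :
    ∃ c : R, Q = galoisCohomology.scalarMap (D.twistOne.toLocal v) (isScalarLinear_toLocal D.isScalarLinear_twistOne v)
      2 c P := by
  obtain ⟨cP, hcP⟩ := D.exists_forall_reading_eq_lam_mul_frob lam hlam exp hexp hfrob v ι₀ P
  obtain ⟨cQ, hcQ⟩ := D.exists_forall_reading_eq_lam_mul_frob lam hlam exp hexp hfrob v ι₀ Q
  -- readings of `H²(a•) z`: `ι H²(exp λ_b)(a • z) = λ(c_z (b a))`
  have hsm : ∀ (z : galoisCohomology (D.twistOne.toLocal v) 2) (cz : R),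
      (∀ b, ι₀ (cohomologyMap (D.expLamLocalHom (lamMul lam b) (lamMul_semilinear lam hlam b) exp hexp v) 2 z) =
        lam (cz * b)) →
      ∀ a b, ι₀ (cohomologyMap (D.expLamLocalHom (lamMul lam b) (lamMul_semilinear lam hlam b) exp hexp v) 2
        (galoisCohomology.scalarMap (D.twistOne.toLocal v) (isScalarLinear_toLocal D.isScalarLinear_twistOne v) 2 a z)) =
        lam (cz * (b * a)) := fun z cz hz a b => by
    rw [D.cohomologyMap_expLam_lamMul_scalarMap_two lam hlam exp hexp v b a z, hz (b * a)]
  -- `ϖ c_P = 0`, `ϖ c_Q = 0`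
  have htors : ∀ (z : galoisCohomology (D.twistOne.toLocal v) 2) (cz : R),
      (∀ b, ι₀ (cohomologyMap (D.expLamLocalHom (lamMul lam b) (lamMul_semilinear lam hlam b) exp hexp v) 2 z) =
        lam (cz * b)) →
      galoisCohomology.scalarMap (D.twistOne.toLocal v) (isScalarLinear_toLocal D.isScalarLinear_twistOne v) 2 ϖ z = 0 →
      ϖ * cz = 0 := fun z cz hz hz0 => by
    refine eq_zero_of_forall_lamMul_apply_eq_zero lam hfrob _ fun b => ?_
    have h := hsm z cz hz ϖ b
    rw [hz0] at h
    rw [show ϖ * cz * b = cz * (b * ϖ) by ring]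
    exact h.symm.trans ((congrArg ι₀ (map_zero _)).trans (map_zero ι₀))
  have hϖP := htors P cP hcP hP
  have hϖQ := htors Q cQ hcQ hQ
  -- `c_P ≠ 0`
  have hcP0 : cP ≠ 0 := by
    intro h0
    apply hP0
    refine D.eq_of_forall_reading_eq_frob lam hlam exp hexp v hdet ι₀ hι₀ P 0 fun b => ?_
    rw [hcP, h0, zero_mul, map_zero]
    exact ((congrArg ι₀ (map_zero _)).trans (map_zero ι₀)).symm
  -- `c_Q = c c_P`
  obtain ⟨c, hc⟩ := hsoc cP cQ hϖP hϖQ hcP0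
  refine ⟨c, D.eq_of_forall_reading_eq_frob lam hlam exp hexp v hdet ι₀ hι₀ _ _ fun b => ?_⟩
  rw [hcQ, hsm P cP hcP c b, hc]
  congr 1
  ring

/-! ## §4 A coordinate function -/

include hlam in
/-- **A coordinate function exists (Frobenius form)**: `coord : H²(K_v, R(1)) → R` with `ι H²(exp ∘ λ_b) z = λ(coord(z) · b)`
for all `b`; additive, `R`-semilinear (`coord(H²(a•) z) = a · coord z`), and `coord z = 0 ↔ z = 0` given H²-detection and
`ι` injective. [cite: Howard2004HeegnerKolyvagin, §1.3 H.4 (arXiv p. 7 L78–82: «⟨ , ⟩_v … → R»)] [cite: MilneADT2006, Ch. I Cor. 2.3] -/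
theorem exists_coord_frob (hfrob : Bijective fun c : R => lamMul lam c) (v : Place K)
    (hdet : ∀ z : galoisCohomology (D.twistOne.toLocal v) 2,
      (∀ b : R, cohomologyMap (D.expLamLocalHom (lamMul lam b) (lamMul_semilinear lam hlam b) exp hexp v) 2 z = 0) →
        z = 0)
    (ι₀ : galoisCohomology ((mu K (p ^ k)).toLocal v) 2 →+ ZMod (p ^ k)) (hι₀ : Injective ι₀) :
    ∃ coord : galoisCohomology (D.twistOne.toLocal v) 2 → R,
      (∀ z b, ι₀ (cohomologyMap (D.expLamLocalHom (lamMul lam b) (lamMul_semilinear lam hlam b) exp hexp v) 2 z) =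
          lam (coord z * b)) ∧
      (∀ z z', coord (z + z') = coord z + coord z') ∧
      (∀ (a : R) z, coord (galoisCohomology.scalarMap (D.twistOne.toLocal v)
          (isScalarLinear_toLocal D.isScalarLinear_twistOne v) 2 a z) = a * coord z) ∧
      ∀ z, coord z = 0 ↔ z = 0 := by
  choose coord hcoord using fun z => D.exists_forall_reading_eq_lam_mul_frob lam hlam exp hexp hfrob v ι₀ z
  refine ⟨coord, hcoord, fun z z' => ?_, fun a z => ?_, fun z => ⟨fun h0 => ?_, fun h0 => ?_⟩⟩
  · refine eq_of_forall_lamMul_apply_eq lam hfrob fun b => ?_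
    rw [add_mul, map_add, ← hcoord, ← hcoord, ← hcoord, ← map_add]
    exact congrArg ι₀ (map_add _ z z')
  · refine eq_of_forall_lamMul_apply_eq lam hfrob fun b => ?_
    rw [← hcoord, D.cohomologyMap_expLam_lamMul_scalarMap_two lam hlam exp hexp v b a z, hcoord]
    congr 1
    ring
  · refine D.eq_of_forall_reading_eq_frob lam hlam exp hexp v hdet ι₀ hι₀ z 0 fun b => ?_
    rw [hcoord, h0, zero_mul, map_zero]
    exact ((congrArg ι₀ (map_zero _)).trans (map_zero ι₀)).symm
  · refine eq_of_forall_lamMul_apply_eq lam hfrob fun b => ?_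
    rw [zero_mul, map_zero, ← hcoord, h0]
    exact (congrArg ι₀ (map_zero _)).trans (map_zero ι₀)

/-! ## §5 At additively free levels the two binders follow from a dualizing family -/

omit [NumberField K] [Module R M] [TopologicalSpace R] [DiscreteTopology R] [Algebra ℤ_[p] R] in
/-- A dualizing family gives the Frobenius property (`exists_eq_lamMul` + `eq_zero_of_forall_lam_mul_eq_zero`).
[cite: Howard2004HeegnerKolyvagin, §1.3 H.4 (arXiv p. 7, L78–82)] -/
theorem bijective_lamMul_of_bijective [Finite R] (hR : ∀ x : R, (p ^ k) • x = 0) {ι : Type} (r : ι → R)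
    (hbij : Bijective fun x : R => fun i : ι => exp (lam (r i * x))) : Bijective fun c : R => lamMul lam c := by
  refine ⟨fun c c' h => ?_, fun φ => ?_⟩
  · rw [← sub_eq_zero]
    refine eq_zero_of_forall_lam_mul_eq_zero lam exp r hbij _ fun i => ?_
    have := DFunLike.congr_fun h (r i)
    rw [lamMul_apply, lamMul_apply, mul_comm c, mul_comm c'] at this
    rw [mul_sub, map_sub, sub_eq_zero, this]
  · obtain ⟨c, hc⟩ := exists_eq_lamMul lam exp hR r hbij φ
    exact ⟨c, hc.symm⟩

end DualityDatum

end Literature.NumberTheory.GaloisCohomology.Howard2004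

end
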